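import Summits.QuantumFields.YangMills.Theorems.LangevinControlUVOSLegsFromFemtoAndGapDefsR3
import HarnessLib

/-!
# Route `LangevinControlUV`, crux `OSLegsAtWeakCouplingC` (stmt-QuantumFields-16207): vocabulary of line `Sketch`

Route-posited objects (D-0016 `<Route><Crux>Defs` file) shared by the registered stubs of the skeleton
`Cruxes/OSLegsAtWeakCouplingC/Lines/Sketch.lean` (lead `prover-line-stmt-QuantumFields-16207-0`, card
`axis-cross-analyticity-e1-locality`) and by the crux work file composing them; VERBATIM the skeleton's §0–§2 (same
namespace `Summit.QuantumFields.YangMills.Cruxes.OSLegsAtWeakCouplingC.Sketch`, so the registered signatures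
`stub_germ : Statement.stub_germ`, `stub_locality : Statement.stub_locality`, `stub_density : Statement.stub_density`
are unchanged).  NOTHING here is asserted: every `def … : Prop` is either a verbatim piece of the crux (`ConclC`;
`cruxC_iff` is `Iff.rfl`; H1–H3 are the stmt-9367 Defs predicates `TwoPoint`/`Skewness`/`GapInUnits`, whose bodies the
C′ decl repeats byte for byte) or a line statement some registered stub proves or consumes (none is a literature fact,
none restates the crux as a claim).  The other four stubs of the skeleton are statements of the predecessor line
`dlr-collar-transfer` of stmt-9367 taken by name (`DlrCollarTransfer.Statement.stub_fcp6` of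
`…OSLegsFromFemtoAndGapDefs.lean`, `.stub_rope`, `.stub_hypercubic`, `.stub_cluster` of `…DefsR3.lean`).

* §0 the crux uncurried: `ConclC`, `cruxC_iff` (`Continuous a → TwoPoint → Skewness → GapInUnits → ConclC`).
* §1 the line's vocabulary: `IsPlanar01` (isometries of the `(x₀,x₁)`-plane), `SmallDiam`, `Separated`, `OffDiagDensity`
  (bounded densities of a one-field family off the big diagonal), `Invariant`, `GermInvariant`, `IsSignedPerm`.
* §2 the three line-internal stub statements `Statement.stub_germ` (E1 at the origin along weak-coupling soft bundles —
  the line's dynamical import), `Statement.stub_locality` (E1 is local at the origin: two-axis reflection positivity +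
  translations + signed permutations + E3 + E0′ + bounded densities ⇒ a planar isometry fixing the germ fixes `⁰𝒮`),
  `Statement.stub_density` (bounded densities of a soft-bundle limit from `MomentBounds6`).

Refs: card `Cruxes/OSLegsAtWeakCouplingC/Ideas/axis-cross-analyticity-e1-locality.md`; `Cruxes/OSLegsAtWeakCouplingC/PICKED.md`;
OsterwalderSchrader1975 Ch. V (5.7)–(5.8) (one-slot continuations, Malgrange–Zerner); GlimmJaffe1987 §6.1, §19;
JaffeWitten2000 §4, §6.
-/

set_option autoImplicit false

noncomputable section

open scoped SchwartzMap ComplexConjugate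
open MeasureTheory Filter Topology
open Literature.MathematicalPhysics.QuantumFieldTheory Literature.MathematicalPhysics.QuantumLattice
open Literature.MathematicalPhysics.AQFT Literature.Probability.LatticeModels
open Summit.QuantumFields.YangMills.Theses.LangevinControlUV (OSLegsAtWeakCouplingC)
open Summit.QuantumFields.YangMills.Cruxes.OSLegsFromFemtoAndGap.DlrCollarTransfer

namespace Summit.QuantumFields.YangMills.Cruxes.OSLegsAtWeakCouplingC.Sketch

local notation "E4" => EuclideanSpace ℝ (Fin 4)

/-! ## §0 The crux, uncurried -/

section Anatomy

variable (G : Type) [Group G] [TopologicalSpace G] [IsTopologicalGroup G] [CompactSpace G]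
  [MeasurableSpace G] [BorelSpace G] (r : LatticeRep G) (a : ℝ → ℝ)

/-- The conclusion of the C′ crux for `(G, r, a)` (verbatim): `Concl` of stmt-9367 plus `sch.HasWeakCouplingLimit`. -/
def ConclC : Prop :=
  ∃ (sch : SpeciesScheme (YMSpecies G)) (T : OSData (YMSpecies G) 4), (∀ k, sch.a k = a (sch.β k)) ∧
    sch.HasWeakCouplingLimit ∧ IsYangMillsFor r sch T ∧ T.IsNontrivial r.curvature ∧ T.IsNonGaussian r.curvature ∧
    ∃ Δ > 0, HasLatticeMassGap r sch Δ

end Anatomy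

/-- §0. The crux uncurried: `Continuous a → H1 → H2 → H3 → ConclC` for every compact simple `G`, every `r`, every
unit map `a` (definitional unfolding of the route decl; H1–H3 are the Defs-file predicates of stmt-9367, whose bodies
C′ repeats byte for byte). -/
theorem cruxC_iff : OSLegsAtWeakCouplingC ↔ ∀ (G : Type) [Group G] [TopologicalSpace G] [IsTopologicalGroup G]
    [CompactSpace G], IsCompactSimpleLieGroup G → letI : MeasurableSpace G := borel G; haveI : BorelSpace G := ⟨rfl⟩;
    ∀ (r : LatticeRep G) (a : ℝ → ℝ), Continuous a → TwoPoint G r a → Skewness G r a → GapInUnits G r a →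
      ConclC G r a :=
  Iff.rfl

/-! ## §1 Vocabulary of the line (nothing posited) -/

/-- A linear isometry acting in the `(x₀,x₁)` coordinate plane only (it fixes `e₂` and `e₃`). -/
def IsPlanar01 (R : E4 ≃ₗᵢ[ℝ] E4) : Prop :=
  R (EuclideanSpace.single 2 1) = EuclideanSpace.single 2 1 ∧ R (EuclideanSpace.single 3 1) = EuclideanSpace.single 3 1

/-- Configurations of diameter `< r₀`. -/
def SmallDiam (n : ℕ) (r₀ : ℝ) : Set (Fin n → E4) := {x | ∀ i j, dist (x i) (x j) < r₀}

/-- Configurations all of whose pairwise distances are `≥ δ`. -/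
def Separated (n : ℕ) (δ : ℝ) : Set (Fin n → E4) := {x | ∀ i j, i ≠ j → δ ≤ dist (x i) (x j)}

/-- **Bounded densities off the diagonal**: on compactly supported test functions supported at pairwise distances
`≥ δ` the `n`-point distribution is bounded by a multiple of the `L¹` norm (i.e. it is an `L∞_loc` function off the
big diagonal).  For a soft-bundle limit this is the collar output `MomentBounds6` read pointwise (`stub_density`). -/
def OffDiagDensity (S₁ : SchwingerFamily E4) : Prop :=
  ∀ (n : ℕ) (δ : ℝ), 0 < δ → ∃ B : ℝ, ∀ F : 𝓢((Fin n → E4), ℂ),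
    HasCompactSupport (F : (Fin n → E4) → ℂ) → tsupport (F : (Fin n → E4) → ℂ) ⊆ Separated n δ →
      ‖S₁ n F‖ ≤ B * ∫ x, ‖F x‖

/-- Invariance of a one-field family under a linear isometry on `⁰𝒮`. -/
def Invariant (S₁ : SchwingerFamily E4) (R : E4 ≃ₗᵢ[ℝ] E4) : Prop :=
  ∀ (n : ℕ) (F : 𝓢((Fin n → E4), ℂ)), IsOffDiagonal F → S₁ n (linActMulti R F) = S₁ n F

/-- Invariance on the GERM: off-diagonal test functions supported in configurations of diameter `< r₀`. -/
def GermInvariant (S₁ : SchwingerFamily E4) (R : E4 ≃ₗᵢ[ℝ] E4) (r₀ : ℝ) : Prop :=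
  ∀ (n : ℕ) (F : 𝓢((Fin n → E4), ℂ)), IsOffDiagonal F →
    tsupport (F : (Fin n → E4) → ℂ) ⊆ SmallDiam n r₀ → S₁ n (linActMulti R F) = S₁ n F

/-- Signed permutations of the coordinate axes (the hyperoctahedral class of `Statement.stub_hypercubic`). -/
def IsSignedPerm (R : E4 ≃ₗᵢ[ℝ] E4) : Prop :=
  ∀ i : Fin 4, ∃ j : Fin 4, R (EuclideanSpace.single i 1) = EuclideanSpace.single j 1 ∨
    R (EuclideanSpace.single i 1) = -EuclideanSpace.single j 1

/-! ## §2 Statements of the three new stubs -/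

/-- **Statement of `stub_germ` — E1 at the origin (IMPORTED, dynamical; the card's C⁺ hypothesis).**  For a compact
simple `G`, a continuous unit map carrying H1 and H3, and any soft bundle in these units (weak coupling `β_k → ∞`,
`a_k L_k → ∞`, joint convergence of the renormalised curvature strings to `S₁`), there is `r₀ > 0` such that `S₁` is
invariant under every isometry of the `(x₀,x₁)`-plane on off-diagonal test functions supported in configurations of
diameter `< r₀`.  Anatomy (card §3): in the limit the perturbative anisotropy vanishes identically (`Λ²ℝ⁴` is
`W(B₄)`-irreducible); the statement is the absence of cubic-harmonic condensates of the dimension-≥6 hypercubic-scalar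
operators.  NOT to be staffed; disprover target. -/
def Statement.stub_germ : Prop :=
  ∀ (G : Type) [Group G] [TopologicalSpace G] [IsTopologicalGroup G] [CompactSpace G]
    [MeasurableSpace G] [BorelSpace G], IsCompactSimpleLieGroup G →
    ∀ (r : LatticeRep G) (a : ℝ → ℝ) (sch : SpeciesScheme (YMSpecies G)) (S₁ : SchwingerFamily E4)
      (Tq : (n : ℕ) → (Fin n → Fin 4 × Fin 4) → (𝓢((Fin n → E4), ℂ) →L[ℂ] ℂ)) (K : ℝ) (b₀ : ℝ) (g : ℝ → ℕ → ℕ),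
      Continuous a → TwoPoint G r a → GapInUnits G r a → SoftBundle G r a sch S₁ Tq K b₀ g →
        ∃ r₀ : ℝ, 0 < r₀ ∧ ∀ R : E4 ≃ₗᵢ[ℝ] E4, IsPlanar01 R → GermInvariant S₁ R r₀

/-- **Statement of `stub_locality` — E1 is local at the origin (the card's lemma; lead's stub).**  For a one-field
family with `S₁ 0 = ev`, translation invariance on `⁰𝒮`, E3, E0′, reflection positivity on positive-time tuples
(`RPPos`), invariance under the signed permutations of the axes (hence reflection positivity along EVERY coordinate
axis) and bounded densities off the diagonal: if an isometry `R` of the `(x₀,x₁)`-plane fixes `S₁` on the germ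
(diameter `< r₀`), it fixes `S₁` on all of `⁰𝒮`.  Mechanism: OS reconstruction along `e₀` and along `e₁`; the
`n`-point distribution smeared in `(x₂,x₃)` is, on each chamber where the `x₀`'s and the `x₁`'s are pairwise
distinct, a jointly real-analytic function of the planar coordinates (one-slot semigroup continuations on the cross,
flat tube theorem); the defect `S₁ ∘ R − S₁` is real-analytic on the finitely many CONVEX CONIC chambers cut out by
these hyperplanes and their `R`-preimages, each containing configurations of arbitrarily small planar diameter, so
it vanishes on a dense open set; the `(x₂,x₃)`-restriction is removed by the same argument in the `e₂`/`e₃` frames;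
the density bound closes the null set. -/
def Statement.stub_locality : Prop :=
  ∀ (S₁ : SchwingerFamily E4),
    (∀ F : 𝓢((Fin 0 → E4), ℂ), S₁ 0 F = F default) →
    (∀ (n : ℕ) (t : E4) (F : 𝓢((Fin n → E4), ℂ)), IsOffDiagonal F → S₁ n (translateMulti t F) = S₁ n F) →
    S₁.toLabelled.IsSymmetric → S₁.toLabelled.HasLinearGrowth → RPPos S₁ →
    (∀ R : E4 ≃ₗᵢ[ℝ] E4, IsSignedPerm R → Invariant S₁ R) →
    OffDiagDensity S₁ →
      ∀ R : E4 ≃ₗᵢ[ℝ] E4, IsPlanar01 R → ∀ r₀ : ℝ, 0 < r₀ → GermInvariant S₁ R r₀ → Invariant S₁ R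

/-- **Statement of `stub_density` — bounded densities of the soft limit off the diagonal.**  Along any soft bundle,
the plane-resolved collar output `MomentBounds6` (`|E ∏ (P − EP)| ≤ (C/R⁴)ⁿ` at torus sup-separation `≥ 2R+4`) read
at `R ≍ δ/a_k` bounds the lattice approximants of `S₁ n` on compactly supported test functions supported at pairwise
distance `≥ δ` by `(C'/δ⁴)ⁿ Σ_x a_k^{4n} |F(a_k x)|` (no wrap-around once `a_k L_k` exceeds the support radius), whose
limit is `(C'/δ⁴)ⁿ ∫ |F|`. -/
def Statement.stub_density : Prop :=
  ∀ (G : Type) [Group G] [TopologicalSpace G] [IsTopologicalGroup G] [CompactSpace G]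
    [MeasurableSpace G] [BorelSpace G] (r : LatticeRep G) (a : ℝ → ℝ)
    (sch : SpeciesScheme (YMSpecies G)) (S₁ : SchwingerFamily E4)
    (Tq : (n : ℕ) → (Fin n → Fin 4 × Fin 4) → (𝓢((Fin n → E4), ℂ) →L[ℂ] ℂ)) (K : ℝ) (b₀ : ℝ) (g : ℝ → ℕ → ℕ),
    MomentBounds6 G r a → SoftBundle G r a sch S₁ Tq K b₀ g → OffDiagDensity S₁

end Summit.QuantumFields.YangMills.Cruxes.OSLegsAtWeakCouplingC.Sketch

end
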